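import Summits.BirchSwinnertonDyer.BirchSwinnertonDyer.Theorems.KolyvaginRoadThreePTCorUnramifiedLocal
import Literature.NumberTheory.GaloisRepresentations.ToLocalRestrictField
import Literature.NumberTheory.GaloisRepresentations.AbsGaloisGroupProofs
import Summits.BirchSwinnertonDyer.BirchSwinnertonDyer.Theorems.KolyvaginRoadThreePTDevissageUnipotentTwoFinal
import Literature.NumberTheory.GaloisRepresentations.ArtinRestriction
import Literature.NumberTheory.GaloisRepresentations.SemiLocalUnits
import Literature.NumberTheory.GaloisRepresentations.PadicAlgebraOfLocalField
import Literature.NumberTheory.NumberFields.CompletionLocalDegreeSum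
import Literature.NumberTheory.EllipticCurves.KummerSelmerStructure
import Literature.NumberTheory.GaloisRepresentations.ContinuousH1OrderTwo
import Literature.NumberTheory.GaloisCohomology.ArchimedeanInvariantMap
import Summits.BirchSwinnertonDyer.BirchSwinnertonDyer.Theorems.KolyvaginRoadThreePTDescentAssembly
import HarnessLib

/-!
# The local corestriction data of the prime-to-`p` descent: conjugators, twists,
# `Res_{w/v}`, `Cor_{w/v}`, and three of the five compatibilities (degree, unramified, places)

Route `KolyvaginRoadThree`, crux `ZhangSharpFrameAtThreeHL` (stmt-BirchSwinnertonDyer-19574), PT road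
(C) (`PT-ROAD-DESIGN-g19.md` §2).  For number fields `K ⊆ K'` (`[Algebra K K']`), a discrete
`Γ_K`-module `ρ` on `M`, a finite place `v` of `K` and a place `w ∣ v` of `K'`
(`w : SemiLocal.Place K K' v`, `K'_w` a `K_v`-algebra by `SemiLocal.algebraPlace`), the module `M`
carries two `Γ_{K'_w}`-structures: `A_w = (ρ|_{Γ_{K'}})|_{Γ_{K'_w}}` (restrict to `K'`, then
localise; this is what Milne I 4.10(b) over `K'` speaks of) and `B_w = (ρ|_{Γ_{K_v}})|_{Γ_{K'_w}}`
(localise, then restrict along `K_v → K'_w`; this is where `Res`/`Cor` of the finite extension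
`K'_w/K_v` live).  The two restriction maps `Γ_{K'_w} → Γ_K` differ by an inner automorphism
(`ToLocalRestrictField.exists_absGaloisRestrict_adicCompletion_eq_conj`), so `ρ` of the conjugator
intertwines `B_w ≅ A_w`.  This file DEFINES

* `conjugator v w : Γ_K` (a choice) with `conjugator_spec`;
* `twistHom ρ v w : B_w →ⁱL A_w`, `twistInv ρ v w : A_w →ⁱL B_w` (`ρ(τ)`, `ρ(τ⁻¹)`), and the induced
  isomorphism `twist ρ v w : H¹(K'_w, B_w) ≃+ H¹(K'_w, A_w)`;
* **`localRes ρ v w := twist ∘ Res_{K'_w/K_v}`** and **`localCor ρ v w := Cor_{K'_w/K_v} ∘ twist⁻¹`**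
  (`galoisCohomology.cor`, p553620) — the data `Res v w`, `Cor v w` of
  `middleExact_canonical_of_descentData` (p555478) for `ρ' = ρ.restrictField K'`;

and PROVES three of its binders for this data:

* (degree) `sum_localCor_localRes : Σ_{w ∣ v} localCor (localRes a) = [K' : K] • a`
  (`cor_res` + `Σ_{w∣v} [K'_w : K_v] = [K' : K]`, `sum_finrank_place_eq_finrank`);
* (unramified) `localCor_mem_unramifiedSubgroup` (`cor_mem_unramifiedSubgroup` + the twist is an
  intertwining isomorphism);
* (places) `isUnramifiedAt_restrictField_place` (inertia above `w` restricts into inertia above `v`);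
* (infinite places) `galoisCohomology_toLocal_inl_eq_zero_of_odd` (`#Γ_{K_w} ≤ 2`, `p` odd).

THEOREMS and definitions with bodies only; no named fact; no case of BSD.

References: [SerreGaloisCohomology1997] I §2.4; [SerreAbelianLadic1968] I §2.1; [CasselsFrohlichANT1967]
Ch. II §10; [NeukirchANT1999] II (8.4), (9.6).
-/

noncomputable section

open CategoryTheory Function NumberField IsDedekindDomain
open scoped NumberField ContRepresentation Classical

set_option linter.dupNamespace false
set_option autoImplicit false

namespace Summit.BirchSwinnertonDyer.BirchSwinnertonDyer.Theorems.KolyvaginRoadThreePT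

open Field
open Literature.NumberTheory.GaloisRepresentations Literature.NumberTheory.GaloisCohomology
open Literature.NumberTheory.GaloisRepresentations.SemiLocal (Place algebraPlace)
open Literature.NumberTheory.NumberFields

section LocalData

variable {K K' : Type} [Field K] [NumberField K] [Field K'] [NumberField K'] [Algebra K K']
variable {M : Type} [AddCommGroup M] [TopologicalSpace M] [DiscreteTopology M]

/-! ## (places) Unramifiedness passes to the places above -/

/-- **If `ρ` is unramified at `v` then `ρ|_{Γ_{K'}}` is unramified at every `w ∣ v`** (the
inertia group at a prime above `w` restricts into the inertia group at the prime below it;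
`exists_primesAbove_restrict`). [cite: SerreAbelianLadic1968, Ch. I §2.1] -/
theorem isUnramifiedAt_restrictField_place {A : Type*} [CommRing A] [TopologicalSpace A]
    {N : Type*} [AddCommGroup N] [Module A N] [TopologicalSpace N] (ρ : GaloisRep K A N)
    (v : HeightOneSpectrum (𝓞 K)) (w : Place K K' v) (hρ : ρ.IsUnramifiedAt v) :
    (ρ.restrictField K').IsUnramifiedAt (w : HeightOneSpectrum (𝓞 K')) := by
  intro 𝔔 h𝔔 γ hγ
  have hw : (w : HeightOneSpectrum (𝓞 K')).asIdeal.under (𝓞 K) = v.asIdeal := by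
    rw [← HeightOneSpectrum.under_asIdeal, w.under_eq]
  obtain ⟨𝔓, h𝔓, hI, -⟩ := exists_primesAbove_restrict K K' hw h𝔔
  rw [GaloisRep.restrictField_apply]
  exact hρ 𝔓 h𝔓 _ (hI γ hγ)

/-! ## The local fields and the conjugator -/

variable (v : HeightOneSpectrum (𝓞 K)) (w : Place K K' v)

/-- `K'_w` is finite-dimensional over `K_v` (`[K'_w : K_v] = e f ≥ 1`). [cite: NeukirchANT1999, Ch. II Prop. (8.5)] -/
theorem finiteDimensional_place' :
    FiniteDimensional (v.adicCompletion K) ((w : HeightOneSpectrum (𝓞 K')).adicCompletion K') :=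
  Module.finite_of_finrank_pos (by
    rw [finrank_place_eq_ramificationIdx_mul_inertiaDeg w]
    exact Nat.mul_pos (Ideal.ramificationIdx_pos _ _) (Ideal.inertiaDeg_pos _ _))

/-- **The embedding conjugator.**  The two `K`-embeddings `K̄ → \overline{K'_w}` — through `K̄'`
(`absClosureEmbedding K' K'_w ∘ absClosureEmbedding K K'`) and through `K̄_v`
(`absClosureEmbedding K_v K'_w ∘ absClosureEmbedding K K_v`) — differ by an element `γ ∈ Γ_K`:
`e_v (γ • x) = e_{K'} x` (Steinitz: `K`-embeddings of `K̄` into an algebraically closed field are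
permuted transitively by `Γ_K`, `exists_absClosureEmbedding_comp_eq`).  This finer datum (not only the
conjugacy of the restriction maps) is what makes the local Tate pairings of the two routes match.
[cite: MilneFT2022, Ch. 6 Thm 6.8 & Rmk 6.9] -/
theorem exists_embeddingConjugator :
    ∃ γ : absoluteGaloisGroup K, ∀ x : AlgebraicClosure K,
      absClosureEmbedding (v.adicCompletion K) ((w : HeightOneSpectrum (𝓞 K')).adicCompletion K')
          (absClosureEmbedding K (v.adicCompletion K) (γ • x)) =
        absClosureEmbedding K' ((w : HeightOneSpectrum (𝓞 K')).adicCompletion K') (absClosureEmbedding K K' x) := by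
  haveI := isScalarTower_adicCompletionOfLiesOver (F := K) (E := K') v (w : HeightOneSpectrum (𝓞 K'))
  obtain ⟨τ₁, h₁⟩ := exists_absClosureEmbedding_comp_eq (K := K)
    (L := (w : HeightOneSpectrum (𝓞 K')).adicCompletion K')
    (((absClosureEmbedding K' ((w : HeightOneSpectrum (𝓞 K')).adicCompletion K')).restrictScalars K).comp
      (absClosureEmbedding K K'))
  obtain ⟨τ₂, h₂⟩ := exists_absClosureEmbedding_comp_eq (K := K)
    (L := (w : HeightOneSpectrum (𝓞 K')).adicCompletion K')
    (((absClosureEmbedding (v.adicCompletion K) ((w : HeightOneSpectrum (𝓞 K')).adicCompletion K')).restrictScalars K).comp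
      (absClosureEmbedding K (v.adicCompletion K)))
  refine ⟨τ₂⁻¹ * τ₁, fun x => ?_⟩
  have e₁ := h₁ x
  have e₂ := h₂ ((τ₂⁻¹ * τ₁) • x)
  rw [smul_smul, ← mul_assoc, mul_inv_cancel, one_mul] at e₂
  rw [AlgHom.comp_apply, AlgHom.restrictScalars_apply] at e₁ e₂
  rw [← e₂, e₁]

/-- **The conjugator `τ_w ∈ Γ_K`** (a choice): the INVERSE of the embedding conjugator, so that
`res_{K'/K} ∘ res_{K'_w/K'} = τ_w · (res_{K_v/K} ∘ res_{K'_w/K_v}) · τ_w⁻¹` (`conjugator_spec`, the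
convention of `exists_absGaloisRestrict_adicCompletion_eq_conj`) AND `e_v (τ_w⁻¹ • x) = e_{K'} x`
(`conjugator_embedding_spec`). [cite: SerreAbelianLadic1968, Ch. I §2.1] -/
def conjugator : absoluteGaloisGroup K :=
  (Classical.choose (exists_embeddingConjugator v w))⁻¹

/-- The embedding property of `conjugator v w`: `e_v (τ_w⁻¹ • x) = e_{K'} x`.
[cite: MilneFT2022, Ch. 6 Thm 6.8 & Rmk 6.9] -/
theorem conjugator_embedding_spec (x : AlgebraicClosure K) :
    absClosureEmbedding (v.adicCompletion K) ((w : HeightOneSpectrum (𝓞 K')).adicCompletion K')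
        (absClosureEmbedding K (v.adicCompletion K) ((conjugator v w)⁻¹ • x)) =
      absClosureEmbedding K' ((w : HeightOneSpectrum (𝓞 K')).adicCompletion K') (absClosureEmbedding K K' x) := by
  rw [conjugator, inv_inv]
  exact Classical.choose_spec (exists_embeddingConjugator v w) x

/-- **The conjugation property of `conjugator v w`**: the two restriction maps `Γ_{K'_w} → Γ_K`
differ by the inner automorphism of `τ_w`. [cite: SerreAbelianLadic1968, Ch. I §2.1] -/
theorem conjugator_spec (σ : absoluteGaloisGroup ((w : HeightOneSpectrum (𝓞 K')).adicCompletion K')) :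
    absGaloisRestrict K K' (absGaloisRestrict K' ((w : HeightOneSpectrum (𝓞 K')).adicCompletion K') σ) =
      conjugator v w * absGaloisRestrict K (v.adicCompletion K)
        (absGaloisRestrict (v.adicCompletion K) ((w : HeightOneSpectrum (𝓞 K')).adicCompletion K') σ) *
        (conjugator v w)⁻¹ := by
  set γ := (conjugator v w)⁻¹ with hγ
  set r₁ := absGaloisRestrict K K' (absGaloisRestrict K' ((w : HeightOneSpectrum (𝓞 K')).adicCompletion K') σ)
  set r₂ := absGaloisRestrict K (v.adicCompletion K)
    (absGaloisRestrict (v.adicCompletion K) ((w : HeightOneSpectrum (𝓞 K')).adicCompletion K') σ)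
  -- `γ r₁ = r₂ γ` by faithfulness of the action on `K̄` and injectivity of `e_v`
  have key : γ * r₁ = r₂ * γ := by
    refine FaithfulSMul.eq_of_smul_eq_smul (α := AlgebraicClosure K) fun x => ?_
    have h1 : absClosureEmbedding (v.adicCompletion K) ((w : HeightOneSpectrum (𝓞 K')).adicCompletion K')
        (absClosureEmbedding K (v.adicCompletion K) ((γ * r₁) • x)) =
        σ • absClosureEmbedding K' ((w : HeightOneSpectrum (𝓞 K')).adicCompletion K') (absClosureEmbedding K K' x) := by
      rw [mul_smul, hγ, conjugator_embedding_spec, absGaloisRestrict_apply_smul, absGaloisRestrict_apply_smul]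
    have h2 : absClosureEmbedding (v.adicCompletion K) ((w : HeightOneSpectrum (𝓞 K')).adicCompletion K')
        (absClosureEmbedding K (v.adicCompletion K) ((r₂ * γ) • x)) =
        σ • absClosureEmbedding K' ((w : HeightOneSpectrum (𝓞 K')).adicCompletion K') (absClosureEmbedding K K' x) := by
      rw [mul_smul, absGaloisRestrict_apply_smul, absGaloisRestrict_apply_smul, hγ, conjugator_embedding_spec]
    apply (absClosureEmbedding K (v.adicCompletion K)).injective
    apply (absClosureEmbedding (v.adicCompletion K) ((w : HeightOneSpectrum (𝓞 K')).adicCompletion K')).injective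
    exact h1.trans h2.symm
  calc r₁ = γ⁻¹ * (γ * r₁) := by group
    _ = γ⁻¹ * (r₂ * γ) := by rw [key]
    _ = conjugator v w * r₂ * (conjugator v w)⁻¹ := by rw [hγ, inv_inv, mul_assoc]

/-! ## The twist `B_w ≅ A_w` and the induced isomorphism on `H¹` -/

variable (ρ : DiscreteGaloisModule K M)

omit [NumberField K] in
/-- `ρ (x y) m = ρ x (ρ y m)`. [cite: SerreAbelianLadic1968, Ch. I §2.1] -/
theorem rep_mul_apply (x y : absoluteGaloisGroup K) (m : M) : ρ (x * y) m = ρ x (ρ y m) := by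
  change ρ.toRepresentation (x * y) m = ρ.toRepresentation x (ρ.toRepresentation y m)
  rw [map_mul]
  rfl

omit [NumberField K] in
/-- `ρ 1 m = m`. [cite: SerreAbelianLadic1968, Ch. I §2.1] -/
theorem rep_one_apply (m : M) : ρ 1 m = m := by
  change ρ.toRepresentation 1 m = m
  rw [map_one]
  rfl

/-- **`ρ(τ_w) : B_w → A_w` intertwines** the two `Γ_{K'_w}`-structures on `M`
(`B_w = (ρ|_{Γ_{K_v}})|_{Γ_{K'_w}}`, `A_w = (ρ|_{Γ_{K'}})|_{Γ_{K'_w}}`). [cite: SerreAbelianLadic1968, Ch. I §2.1] -/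
def twistHom :
    ((GaloisRep.toLocal v ρ).restrictField ((w : HeightOneSpectrum (𝓞 K')).adicCompletion K')).toContRepresentation →ⁱL
      (GaloisRep.toLocal (w : HeightOneSpectrum (𝓞 K')) (ρ.restrictField K')).toContRepresentation where
  toContinuousLinearMap := ⟨ρ (conjugator v w), continuous_of_discreteTopology⟩
  isIntertwining' σ := ContinuousLinearMap.ext fun m => by
    change ρ (conjugator v w) (ρ (absGaloisRestrict K (v.adicCompletion K)
        (absGaloisRestrict (v.adicCompletion K) ((w : HeightOneSpectrum (𝓞 K')).adicCompletion K') σ)) m) =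
      ρ (absGaloisRestrict K K' (absGaloisRestrict K' ((w : HeightOneSpectrum (𝓞 K')).adicCompletion K') σ))
        (ρ (conjugator v w) m)
    rw [conjugator_spec, ← rep_mul_apply, ← rep_mul_apply]
    have e : conjugator v w * absGaloisRestrict K (v.adicCompletion K)
        (absGaloisRestrict (v.adicCompletion K) ((w : HeightOneSpectrum (𝓞 K')).adicCompletion K') σ) *
        (conjugator v w)⁻¹ * conjugator v w = conjugator v w * absGaloisRestrict K (v.adicCompletion K)
        (absGaloisRestrict (v.adicCompletion K) ((w : HeightOneSpectrum (𝓞 K')).adicCompletion K') σ) := by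
      group
    rw [e]

/-- Unfolding `twistHom`. [cite: SerreAbelianLadic1968, Ch. I §2.1] -/
@[simp]
theorem twistHom_apply (m : M) : twistHom v w ρ m = ρ (conjugator v w) m := rfl

/-- **`ρ(τ_w⁻¹) : A_w → B_w`**, the inverse intertwining map. [cite: SerreAbelianLadic1968, Ch. I §2.1] -/
def twistInv :
    (GaloisRep.toLocal (w : HeightOneSpectrum (𝓞 K')) (ρ.restrictField K')).toContRepresentation →ⁱL
      ((GaloisRep.toLocal v ρ).restrictField ((w : HeightOneSpectrum (𝓞 K')).adicCompletion K')).toContRepresentation where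
  toContinuousLinearMap := ⟨ρ (conjugator v w)⁻¹, continuous_of_discreteTopology⟩
  isIntertwining' σ := ContinuousLinearMap.ext fun m => by
    change ρ (conjugator v w)⁻¹
        (ρ (absGaloisRestrict K K' (absGaloisRestrict K' ((w : HeightOneSpectrum (𝓞 K')).adicCompletion K') σ)) m) =
      ρ (absGaloisRestrict K (v.adicCompletion K)
        (absGaloisRestrict (v.adicCompletion K) ((w : HeightOneSpectrum (𝓞 K')).adicCompletion K') σ))
        (ρ (conjugator v w)⁻¹ m)
    rw [conjugator_spec, ← rep_mul_apply, ← rep_mul_apply]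
    have e : (conjugator v w)⁻¹ * (conjugator v w * absGaloisRestrict K (v.adicCompletion K)
        (absGaloisRestrict (v.adicCompletion K) ((w : HeightOneSpectrum (𝓞 K')).adicCompletion K') σ) *
        (conjugator v w)⁻¹) = absGaloisRestrict K (v.adicCompletion K)
        (absGaloisRestrict (v.adicCompletion K) ((w : HeightOneSpectrum (𝓞 K')).adicCompletion K') σ) *
        (conjugator v w)⁻¹ := by
      group
    rw [e]

/-- Unfolding `twistInv`. [cite: SerreAbelianLadic1968, Ch. I §2.1] -/
@[simp]
theorem twistInv_apply (m : M) : twistInv v w ρ m = ρ (conjugator v w)⁻¹ m := rfl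

/-- `ρ(τ⁻¹) (ρ(τ) m) = m`. [cite: SerreAbelianLadic1968, Ch. I §2.1] -/
theorem twistInv_twistHom (m : M) : twistInv v w ρ (twistHom v w ρ m) = m := by
  rw [twistInv_apply, twistHom_apply, ← rep_mul_apply, inv_mul_cancel, rep_one_apply]

/-- `ρ(τ) (ρ(τ⁻¹) m) = m`. [cite: SerreAbelianLadic1968, Ch. I §2.1] -/
theorem twistHom_twistInv (m : M) : twistHom v w ρ (twistInv v w ρ m) = m := by
  rw [twistInv_apply, twistHom_apply, ← rep_mul_apply, mul_inv_cancel, rep_one_apply]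

/-- **The twist isomorphism `H¹(K'_w, B_w) ≃+ H¹(K'_w, A_w)`** induced by `ρ(τ_w)` (inverse induced
by `ρ(τ_w⁻¹)`). [cite: SerreGaloisCohomology1997, I §2.4] -/
def twist :
    galoisCohomology ((GaloisRep.toLocal v ρ).restrictField ((w : HeightOneSpectrum (𝓞 K')).adicCompletion K')) 1 ≃+
      galoisCohomology (GaloisRep.toLocal (w : HeightOneSpectrum (𝓞 K')) (ρ.restrictField K')) 1 where
  toFun := galoisCohomology.map (twistHom v w ρ) 1
  invFun := galoisCohomology.map (twistInv v w ρ) 1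
  left_inv y := galoisCohomology.map_one_map_one_eq_self_of_comp_eq _ _ (twistInv_twistHom v w ρ) y
  right_inv y := galoisCohomology.map_one_map_one_eq_self_of_comp_eq _ _ (twistHom_twistInv v w ρ) y
  map_add' := map_add _

/-- Unfolding `twist`. [cite: SerreGaloisCohomology1997, I §2.4] -/
theorem twist_apply
    (y : galoisCohomology ((GaloisRep.toLocal v ρ).restrictField ((w : HeightOneSpectrum (𝓞 K')).adicCompletion K')) 1) :
    twist v w ρ y = galoisCohomology.map (twistHom v w ρ) 1 y := rfl

/-- Unfolding `twist.symm`. [cite: SerreGaloisCohomology1997, I §2.4] -/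
theorem twist_symm_apply
    (z : galoisCohomology (GaloisRep.toLocal (w : HeightOneSpectrum (𝓞 K')) (ρ.restrictField K')) 1) :
    (twist v w ρ).symm z = galoisCohomology.map (twistInv v w ρ) 1 z := rfl

/-! ## `Res_{w/v}` and `Cor_{w/v}` -/

/-- **`Res_{w/v} : H¹(K_v, M) → H¹(K'_w, A_w)`** — restriction along `K_v → K'_w` followed by the twist.
[cite: SerreGaloisCohomology1997, I §2.4] -/
def localRes :
    galoisCohomology (GaloisRep.toLocal v ρ) 1 →+
      galoisCohomology (GaloisRep.toLocal (w : HeightOneSpectrum (𝓞 K')) (ρ.restrictField K')) 1 :=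
  (twist v w ρ).toAddMonoidHom.comp
    (galoisCohomology.res (GaloisRep.toLocal v ρ) ((w : HeightOneSpectrum (𝓞 K')).adicCompletion K') 1)

/-- **`Cor_{w/v} : H¹(K'_w, A_w) → H¹(K_v, M)`** — the inverse twist followed by the corestriction of
the finite extension `K'_w/K_v` (`galoisCohomology.cor`). [cite: SerreGaloisCohomology1997, I §2.4] -/
def localCor :
    galoisCohomology (GaloisRep.toLocal (w : HeightOneSpectrum (𝓞 K')) (ρ.restrictField K')) 1 →+
      galoisCohomology (GaloisRep.toLocal v ρ) 1 := by
  haveI := LocalField.charZero_adicCompletion v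
  haveI := finiteDimensional_place' v w
  exact (galoisCohomology.cor (GaloisRep.toLocal v ρ) ((w : HeightOneSpectrum (𝓞 K')).adicCompletion K')).comp
    (twist v w ρ).symm.toAddMonoidHom

/-- Unfolding `localRes`. [cite: SerreGaloisCohomology1997, I §2.4] -/
theorem localRes_apply (a : galoisCohomology (GaloisRep.toLocal v ρ) 1) :
    localRes v w ρ a = twist v w ρ
      (galoisCohomology.res (GaloisRep.toLocal v ρ) ((w : HeightOneSpectrum (𝓞 K')).adicCompletion K') 1 a) :=
  rfl

/-- Unfolding `localCor`. [cite: SerreGaloisCohomology1997, I §2.4] -/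
theorem localCor_apply
    (z : galoisCohomology (GaloisRep.toLocal (w : HeightOneSpectrum (𝓞 K')) (ρ.restrictField K')) 1) :
    localCor v w ρ z =
      @galoisCohomology.cor _ _ (LocalField.charZero_adicCompletion v) _ _ _ _ (GaloisRep.toLocal v ρ)
        ((w : HeightOneSpectrum (𝓞 K')).adicCompletion K') _ _ (finiteDimensional_place' v w)
        ((twist v w ρ).symm z) :=
  rfl

/-! ## (degree) `Σ_{w ∣ v} Cor_{w/v} ∘ Res_{w/v} = [K' : K]` -/

/-- `Cor_{w/v} (Res_{w/v} a) = [K'_w : K_v] • a`. [cite: SerreGaloisCohomology1997, I §2.4 Prop. 9] -/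
theorem localCor_localRes (a : galoisCohomology (GaloisRep.toLocal v ρ) 1) :
    localCor v w ρ (localRes v w ρ a) =
      Module.finrank (v.adicCompletion K) ((w : HeightOneSpectrum (𝓞 K')).adicCompletion K') • a := by
  haveI := LocalField.charZero_adicCompletion v
  haveI := finiteDimensional_place' v w
  rw [localCor_apply, localRes_apply, AddEquiv.symm_apply_apply]
  convert galoisCohomology.cor_res (GaloisRep.toLocal v ρ) ((w : HeightOneSpectrum (𝓞 K')).adicCompletion K') a

/-- **(degree) `Σ_{w ∣ v} Cor_{w/v} (Res_{w/v} a) = [K' : K] • a`** (`Σ_{w∣v} [K'_w : K_v] = [K' : K]`,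
Cassels–Fröhlich II §10). [cite: CasselsFrohlichANT1967, Ch. II §10] -/
theorem sum_localCor_localRes (a : galoisCohomology (GaloisRep.toLocal v ρ) 1) :
    ∑ w : Place K K' v, localCor v w ρ (localRes v w ρ a) = Module.finrank K K' • a := by
  simp only [localCor_localRes]
  rw [← Finset.sum_smul, sum_finrank_place_eq_finrank]

/-! ## (unramified) `Cor_{w/v}` preserves unramified classes -/

/-- **(unramified) `Cor_{w/v}` maps `H¹_ur(K'_w, A_w)` into `H¹_ur(K_v, M)`**: the twist is induced by an
intertwining isomorphism (so it respects the unramified subgroups: restriction to the maximal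
unramified extension commutes with `H¹(ρ(τ⁻¹))`, `galoisCohomology.res_map_one`), and the corestriction
of `K'_w/K_v` preserves unramified classes (`cor_mem_unramifiedSubgroup`).
[cite: MilneADT2006, Ch. I §2 (unramified cohomology)] -/
theorem localCor_mem_unramifiedSubgroup
    (z : galoisCohomology (GaloisRep.toLocal (w : HeightOneSpectrum (𝓞 K')) (ρ.restrictField K')) 1)
    (hz : z ∈ DiscreteGaloisModule.unramifiedSubgroup
      (GaloisRep.toLocal (w : HeightOneSpectrum (𝓞 K')) (ρ.restrictField K')) 1) :
    localCor v w ρ z ∈ DiscreteGaloisModule.unramifiedSubgroup (GaloisRep.toLocal v ρ) 1 := by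
  haveI := LocalField.charZero_adicCompletion v
  haveI := finiteDimensional_place' v w
  rw [localCor_apply, twist_symm_apply]
  refine cor_mem_unramifiedSubgroup (GaloisRep.toLocal v ρ) _ ?_
  rw [DiscreteGaloisModule.mem_unramifiedSubgroup_iff, galoisCohomology.res_map_one,
    (DiscreteGaloisModule.mem_unramifiedSubgroup_iff _ 1 z).mp hz, map_zero]

/-! ## (infinite places) `H¹(K_w, M) = 0` for `p` odd -/

/-- **`H¹(K_w, M) = 0` at an infinite place `w` when `M` is killed by an odd `p`**: `Γ_{K_w}` has
order `≤ 2`, so `H¹` is killed by `2` and by `p`. (The binder `hKinf` of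
`middleExact_canonical_of_descentData`.) [cite: SerreGaloisCohomology1997, I §2.4 (Cor. of Prop. 9)] -/
theorem galoisCohomology_toLocal_inl_eq_zero_of_odd {p : ℕ} (hp : Odd p) (hpM : ∀ m : M, p • m = 0)
    (winf : InfinitePlace K) (a : galoisCohomology (ρ.toLocal (Sum.inl winf)) 1) : a = 0 := by
  haveI : Finite (absoluteGaloisGroup (Place.Completion (Sum.inl winf : Place K))) :=
    finite_absoluteGaloisGroup_completion_infinitePlace winf
  exact eq_zero_of_odd_nsmul_eq_zero_of_natCard_le_two
    (natCard_absoluteGaloisGroup_placeCompletion_inl_le_two K winf) _ hp a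
    (galoisCohomology_one_nsmul_eq_zero _ hpM a)

end LocalData

end Summit.BirchSwinnertonDyer.BirchSwinnertonDyer.Theorems.KolyvaginRoadThreePT

end
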